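import Summits.AtomisticToContinuum.FouriersLaw.Theorems.LatticeLandauDampingFloorGap
import Summits.AtomisticToContinuum.FouriersLaw.Theorems.BondHeatUncertaintyBoundedResponseStorageLeakA
import Literature.MathematicalPhysics.KineticTheory.LangevinChainScalingLimit
import HarnessLib

/-!
# `BondHeatUncertainty.BoundedResponse` — (V) `EnergyFluctuationExtensive` PROVED (lens-1 g95; the storage grade of NODE 95E)

Decomposition cell `decomp-a2c`, lens «grading / quantitative ladder», generation 95.  NODE 95E «StorageLeak»
(`…BondHeatUncertaintyBoundedResponseStorageLeak{A,}.lean`) cut the residual (D) `DeficitCesaroPoint` of lens-1's line on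
`BondHeatUncertainty.BoundedResponse` (stmt 11071) by the first law in linear response, (D) ⟸ (D_S) `StorageBound` ∧ (D_F)
`LeakPoint`, and proved (D_S) ⟸ (V) `EnergyFluctuationExtensive` ∧ (C₁) `CorrectorGrade 1` (`storageBound_of_grades`); door of
record v6: `boundedResponse_of_leakPoint_grades : LeakPoint → CorrectorGrade 1 → EnergyFluctuationExtensive → BoundedResponse`.
This file PROVES the thermodynamic grade (V) outright:

  `energyFluctuationExtensive_holds : EnergyFluctuationExtensive` — `Var_{μ_T}(H_N) ≤ C(ω₂, λ, β, T)·N` for EVERY `N`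
  (extensive heat capacity of the pinned anharmonic chain at equilibrium `T_L = T_R = T`), with the explicit constant
  `C = T² + (T/ω₂)·K₁`, `K₁ = 3K₀(1 + T/ω₂ + 90(T/ω₂)³)`, `K₀ = 6(ω₂² + λ²) + 24 + 384β²` (`gradConst`).

Consequently the door v6 needs only (D_F) `LeakPoint` ∧ (C₁) `CorrectorGrade 1`, and with the hanger
`correctorGrade_one_of_kineticCorrectorBudget` (`…StorageLeakHanger.lean`) only (D_F) ∧ `KineticCorrectorBudget` (KCB, 33857).

## Proof — a Brascamp–Lieb moment ladder in position space + the kinetic covariance (no integration by parts)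

Write `H(q,p) = ∑ᵢ pᵢ²/2 + U_N(q)` (`hamiltonian_eq_kin_add_potEnergy`), `w = e^{−U_N/T}` (`potWeight`), `Z = ∫ w`, `c = T/ω₂`.
* §V.1 `potWeight_poincare`: the Brascamp–Lieb variance inequality [cite: BrascampLieb1976, Thm 4.1]
  (`BrascampLieb1976_thm41_uniform_holds`) for the uniformly convex `U_N/T` (`floorGap_firstOrderConvex`, modulus `ω₂/T`),
  transported from `EuclideanSpace ℝ (Fin N)` to `Fin N → ℝ` along `PiLp.volume_preserving_toLp` as in `floorGap_main`:
  `∫ (f − m_f)² w ≤ (T/ω₂) ∫ (∑ᵢ (∂ᵢf)²) w`, `m_f = (∫ f w)/Z`, for `f ∈ C¹` with `f w, f² w, |∇f|² w ∈ L¹`.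
* §V.2 integrability of polynomial site moments (`(qᵢ²)ⁿ ≤ n!(4T/ω₂)ⁿ e^{U_N/(2T)}`; domination of `g·w_T` by `w_{2T}`), evenness
  of `w` ⇒ odd site moments vanish (`integral_odd_mul_potWeight`; reflection invariance of Lebesgue measure), and the LADDER
  `moments_le`: `∫ qᵢ² w ≤ cZ`, `∫ qᵢ⁴ w ≤ 10c²Z`, `∫ qᵢ⁶ w ≤ 90c³Z` (Poincaré for `f = qᵢ, qᵢ², qᵢ³`), uniformly in `i` and `N`.
* §V.3 `coordDeriv_potEnergy` (closed form of `∂ᵢU_N`: `partialQ_hamiltonian_eq_dPotential` + `dPotential_eq_closed`) and the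
  pointwise bound `(∂ᵢU_N)² ≤ K₀·(Λ(qᵢ) + [0<i]Λ(qᵢ₋₁) + [i+1<N]Λ(qᵢ₊₁))`, `Λ(s) = 1 + s² + s⁶`; hence
  `∫ (∂ᵢU_N)² w ≤ 3K₀(1 + c + 90c³)·Z` per site (`integral_sq_coordDeriv_potEnergy_le`).
* §V.4 summing over the sites, `∫ |∇U_N|² w ≤ N·K₁·Z`; Brascamp–Lieb for `f = U_N`: `∫ (U_N − m_U)² w ≤ (T/ω₂)·N·K₁·Z` (`potFluct_le`).
* §V.5 the `q`-marginal of `μ_T` is `w/Z`: `∫ g(q) dμ_T = (∫ g w)/Z` (`integral_comp_fst_gibbsMeasure`; `e^{−H/T} = w(q)·e^{−|p|²/(2T)}`,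
  `Measure.volume_eq_prod`, `integral_prod_mul`).
* §V.6 with `θᵢ = pᵢ² − T`, `H̃ = H − ⟨H⟩`: `H̃ = ½∑ᵢθᵢ + (U_N − const)` pointwise, so `Var H = ⟨H̃·½∑ᵢθᵢ⟩ + ⟨H̃·(U_N∘fst − m_U)⟩`
  (`∫ H̃ = 0` absorbs the constant); the first term is `N T²/2` (`IncoherentBounded.integral_kinObs_mul_hamiltonian`: `⟨θᵢH⟩ = T²`;
  `integral_kinObs`: `⟨θᵢ⟩ = 0`), the second is `≤ ½Var H + ½Var(U_N∘fst)` (AM–GM), and `Var(U_N∘fst) = (∫(U_N − m_U)²w)/Z ≤ (T/ω₂)K₁N`.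
  Hence `Var H ≤ N T² + (T/ω₂)K₁N`.  (`N = 0`: `H ≡ 0`.)  All `μ_T`-integrabilities come from `|g| ≤ A e^{ϑH}`, `ϑ = 1/(4T)`
  (`integrable_gibbs_of_abs_le`, `centredHamiltonian_facts`, `abs_kinObs_le`, `IncoherentBounded.hamiltonian_le_exp`).

Imports ONLY tree modules (`…LatticeLandauDampingFloorGap` for the transport template and `floorGap_*`,
`…BondHeatUncertaintyBoundedResponseStorageLeakA` for the target and the `μ_T` facts, `Literature…LangevinChainScalingLimit` for
`dPotential_eq_closed`).  Restates nothing.  0 sorry; standard axioms; every declaration carries a docstring.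
Landing form (hand-2 lane): this file verbatim as `Theorems/BondHeatUncertaintyBoundedResponseEnergyFluctuation.lean`,
`--supports stmt-AtomisticToContinuum-11071`.

PART A of three (lane cap ≤ 400 lines; critic row 1357 (4)): §V.1 (defs `potEnergy`, `potWeight`, `coordDeriv`; `potWeight_poincare`) and the
head of §V.2 (regularity, symmetry, integrability of polynomial moments, `integral_sq_mul_le_of_centred`).  Part B
(`…EnergyFluctuationB`) = the moment ladder `moments_le`, §V.3, §V.4; the final part (`…EnergyFluctuation`) = §V.5, §V.6 and the theorem.
-/

noncomputable section

open MeasureTheory ProbabilityTheory Filter Topology Set Function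
open scoped NNReal ENNReal ContDiff RealInnerProductSpace
open Literature.MathematicalPhysics.KineticTheory.HeatConduction
open Literature.MathematicalPhysics.KineticTheory OscillatorChain

namespace Summit.AtomisticToContinuum.FouriersLaw.Theorems.BoundedResponse.ParityFloor

section EnergyFluctuation

variable {ω₂ lam β γ T : ℝ}

/-! ### §V.1 The position weight and its Poincaré inequality for square-integrable observables -/

/-- The potential energy `U_N(q) = H_N(q, 0) = (ω₂/2)∑qᵢ² + ∑ lam qᵢ⁴/4 + ∑_bonds ((q_{i+1}−qᵢ)²/2 + β(q_{i+1}−qᵢ)⁴/4)` of the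
pinned chain (independent of the bath coupling). [folklore] -/
def potEnergy (ω₂ lam β : ℝ) (N : ℕ) (q : Fin N → ℝ) : ℝ :=
  (pinnedChain ω₂ lam β 0).hamiltonian N (q, fun _ => 0)

/-- The position Gibbs weight `w(q) = exp(−U_N(q)/T)`. [folklore] -/
def potWeight (ω₂ lam β T : ℝ) (N : ℕ) (q : Fin N → ℝ) : ℝ :=
  Real.exp (-(potEnergy ω₂ lam β N q / T))

/-- The coordinate partial derivative `∂ᵢ f(q) = d/ds f(q with qᵢ := s)|_{s = qᵢ}`. [folklore] -/
def coordDeriv {N : ℕ} (i : Fin N) (f : (Fin N → ℝ) → ℝ) (q : Fin N → ℝ) : ℝ :=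
  deriv (fun s : ℝ => f (Function.update q i s)) (q i)

/-- `w > 0`. [folklore] -/
theorem potWeight_pos (ω₂ lam β T : ℝ) (N : ℕ) (q : Fin N → ℝ) : 0 < potWeight ω₂ lam β T N q :=
  Real.exp_pos _

/-- **Poincaré inequality for the position weight, square-integrable version**: for `ω₂ > 0`, `lam, β ≥ 0`, `T > 0` and
`f ∈ C¹(ℝ^N)` with `f w`, `f² w`, `|∇f|² w` integrable,
`∫ (f − m_f)² w ≤ (T/ω₂) ∫ (∑ᵢ (∂ᵢf)²) w`, `m_f = (∫ f w)/(∫ w)` — the tree's Brascamp–Lieb inequality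
`BrascampLieb1976_thm41_uniform_holds` at `Φ = U_N/T` (first-order `ω₂/T`-convex, `floorGap_firstOrderConvex`), transported from
`EuclideanSpace ℝ (Fin N)` (as in `floorGap_main`, with boundedness replaced by integrability). [cite: BrascampLieb1976, Thm 4.1] -/
theorem potWeight_poincare (hω : 0 < ω₂) (hl : 0 ≤ lam) (hβ : 0 ≤ β) (hT : 0 < T) (N : ℕ)
    (f : (Fin N → ℝ) → ℝ) (hf : ContDiff ℝ 1 f)
    (h1 : Integrable fun q => f q * potWeight ω₂ lam β T N q)
    (h2 : Integrable fun q => f q ^ 2 * potWeight ω₂ lam β T N q)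
    (h3 : Integrable fun q => (∑ i, coordDeriv i f q ^ 2) * potWeight ω₂ lam β T N q) :
    ∫ q, (f q - (∫ q, f q * potWeight ω₂ lam β T N q) / ∫ q, potWeight ω₂ lam β T N q) ^ 2 *
        potWeight ω₂ lam β T N q ≤
      T / ω₂ * ∫ q, (∑ i, coordDeriv i f q ^ 2) * potWeight ω₂ lam β T N q := by
  set Φ : EuclideanSpace ℝ (Fin N) → ℝ := fun z =>
    (pinnedChain ω₂ lam β 0).hamiltonian N (WithLp.ofLp z, fun _ => 0) / T with hΦ_def
  set F : EuclideanSpace ℝ (Fin N) → ℝ := fun z => f (WithLp.ofLp z) with hF_def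
  have hκ : 0 < ω₂ / T := div_pos hω hT
  have hHc : ContDiff ℝ 2 fun q : Fin N → ℝ =>
      (pinnedChain ω₂ lam β 0).hamiltonian N (q, fun _ => 0) :=
    ((pinnedChain ω₂ lam β 0).contDiff_hamiltonian (pinnedChain_contDiff_U ω₂ lam β 0)
      (pinnedChain_contDiff_V ω₂ lam β 0) N).comp (contDiff_id.prodMk contDiff_const)
  have hΦc : ContDiff ℝ 2 Φ := (hHc.comp PiLp.contDiff_ofLp).div_const T
  have hFc : ContDiff ℝ 1 F := hf.comp PiLp.contDiff_ofLp
  have hfd : Differentiable ℝ f := hf.differentiable one_ne_zero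
  have hconv : ∀ x y : EuclideanSpace ℝ (Fin N),
      Φ x + ⟪gradient Φ x, y - x⟫ + ω₂ / T / 2 * ‖y - x‖ ^ 2 ≤ Φ y :=
    fun x y => floorGap_firstOrderConvex hl hβ hT N x y
  have hZ : Integrable fun x => Real.exp (-Φ x) :=
    Literature.Analysis.FunctionSpaces.integrable_exp_neg_of_uniformlyConvex hκ hΦc.continuous hconv
  have hmp := PiLp.volume_preserving_toLp (Fin N)
  have hemb := (MeasurableEquiv.toLp 2 (Fin N → ℝ)).measurableEmbedding
  have hI : ∀ g : EuclideanSpace ℝ (Fin N) → ℝ,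
      ∫ x, g x = ∫ q : Fin N → ℝ, g (WithLp.toLp 2 q) := fun g => (hmp.integral_comp hemb g).symm
  have hT1 : Integrable fun x => F x * Real.exp (-Φ x) := (hmp.integrable_comp_emb hemb).1 h1
  have hT2 : Integrable fun x => F x ^ 2 * Real.exp (-Φ x) := (hmp.integrable_comp_emb hemb).1 h2
  have hT3 : Integrable fun x => ‖gradient F x‖ ^ 2 * Real.exp (-Φ x) := by
    refine (hmp.integrable_comp_emb hemb).1 (h3.congr (Eventually.of_forall fun q => ?_))
    show _ = ‖gradient F (WithLp.toLp 2 q)‖ ^ 2 * Real.exp (-Φ (WithLp.toLp 2 q))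
    rw [hF_def, floorGap_norm_gradient_sq hfd]
    rfl
  have key := Literature.Probability.Moments.BrascampLieb1976_thm41_uniform_holds N Φ F (ω₂ / T) hκ
    hΦc hFc hconv hZ hT1 hT2 hT3
  dsimp only at key
  rw [hI, hI, hI, hI] at key
  simp only [hF_def, hΦ_def, floorGap_norm_gradient_sq hfd, inv_div] at key
  exact key

/-! ### §V.2 The position weight: regularity, integrability of polynomial moments, symmetry -/

section Position

variable {N : ℕ}

/-- `U_N ≥ 0`. [folklore] -/
theorem potEnergy_nonneg (hω : 0 ≤ ω₂) (hl : 0 ≤ lam) (hβ : 0 ≤ β) (q : Fin N → ℝ) :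
    0 ≤ potEnergy ω₂ lam β N q :=
  pinnedChain_hamiltonian_nonneg hω hl hβ 0 N _

/-- A single pinning spring is below the potential energy: `ω₂ qᵢ²/2 ≤ U_N(q)`. [folklore] -/
theorem sq_le_potEnergy (hω : 0 ≤ ω₂) (hl : 0 ≤ lam) (hβ : 0 ≤ β) (q : Fin N → ℝ) (i : Fin N) :
    ω₂ * q i ^ 2 / 2 ≤ potEnergy ω₂ lam β N q := by
  have h := pinnedChain_U_le_hamiltonian hω hl hβ 0 N ((q, fun _ => 0) : PhaseSpace N) i
  have h4 : 0 ≤ lam * q i ^ 4 / 4 := by positivity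
  unfold potEnergy
  dsimp only at h
  linarith

/-- `U_N ∈ C²`. [folklore] -/
theorem contDiff_potEnergy : ContDiff ℝ 2 (potEnergy ω₂ lam β N) :=
  ((pinnedChain ω₂ lam β 0).contDiff_hamiltonian (pinnedChain_contDiff_U ω₂ lam β 0)
      (pinnedChain_contDiff_V ω₂ lam β 0) N).comp (contDiff_id.prodMk contDiff_const)

/-- `U_N` is continuous. [folklore] -/
theorem continuous_potEnergy : Continuous (potEnergy ω₂ lam β N) :=
  contDiff_potEnergy.continuous

/-- `w` is continuous. [folklore] -/
theorem continuous_potWeight : Continuous (potWeight ω₂ lam β T N) :=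
  Real.continuous_exp.comp (continuous_potEnergy.div_const T).neg

/-- `U_N` is even: `U_N(−q) = U_N(q)`. [folklore] -/
theorem potEnergy_neg (q : Fin N → ℝ) : potEnergy ω₂ lam β N (-q) = potEnergy ω₂ lam β N q := by
  simp only [potEnergy, floorGap_hamiltonian_q_eq, Pi.neg_apply]
  congr 1
  · congr 1
    exact Finset.sum_congr rfl fun i _ => by ring
  · congr 1
    · exact Finset.sum_congr rfl fun i _ => by ring
    · exact Finset.sum_congr rfl fun i _ => Finset.sum_congr rfl fun j _ => by split_ifs <;> ring

/-- `w` is even. [folklore] -/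
theorem potWeight_neg (q : Fin N → ℝ) : potWeight ω₂ lam β T N (-q) = potWeight ω₂ lam β T N q := by
  simp only [potWeight, potEnergy_neg]

/-- **Odd observables have zero mean under `w`**: `∫ g w = 0` whenever `g(−q) = −g(q)` (the weight is even and Lebesgue
measure on `ℝ^N` is reflection invariant). [folklore] -/
theorem integral_odd_mul_potWeight {g : (Fin N → ℝ) → ℝ} (hodd : ∀ q, g (-q) = -g q) :
    ∫ q, g q * potWeight ω₂ lam β T N q = 0 := by
  haveI : (volume : Measure (Fin N → ℝ)).IsNegInvariant :=
    Measure.IsAddHaarMeasure.isNegInvariant_of_regular _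
  have h := integral_neg_eq_self (fun q => g q * potWeight ω₂ lam β T N q) (volume : Measure (Fin N → ℝ))
  simp only [hodd, potWeight_neg, neg_mul, integral_neg] at h
  linarith

/-- `w` is integrable at every temperature `T > 0` (transport of `integrable_exp_neg_of_uniformlyConvex`). [folklore] -/
theorem integrable_potWeight (hω : 0 < ω₂) (hl : 0 ≤ lam) (hβ : 0 ≤ β) (hT : 0 < T) :
    Integrable (potWeight ω₂ lam β T N) := by
  set Φ : EuclideanSpace ℝ (Fin N) → ℝ := fun z =>
    (pinnedChain ω₂ lam β 0).hamiltonian N (WithLp.ofLp z, fun _ => 0) / T with hΦ_def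
  have hκ : 0 < ω₂ / T := div_pos hω hT
  have hΦc : ContDiff ℝ 2 Φ := (contDiff_potEnergy.comp PiLp.contDiff_ofLp).div_const T
  have hconv : ∀ x y : EuclideanSpace ℝ (Fin N),
      Φ x + ⟪gradient Φ x, y - x⟫ + ω₂ / T / 2 * ‖y - x‖ ^ 2 ≤ Φ y :=
    fun x y => floorGap_firstOrderConvex hl hβ hT N x y
  have hZ : Integrable fun x => Real.exp (-Φ x) :=
    Literature.Analysis.FunctionSpaces.integrable_exp_neg_of_uniformlyConvex hκ hΦc.continuous hconv
  exact ((PiLp.volume_preserving_toLp (Fin N)).integrable_comp_emb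
    (MeasurableEquiv.toLp 2 (Fin N → ℝ)).measurableEmbedding).2 hZ

/-- `Z = ∫ w > 0`. [folklore] -/
theorem integral_potWeight_pos (hω : 0 < ω₂) (hl : 0 ≤ lam) (hβ : 0 ≤ β) (hT : 0 < T) :
    0 < ∫ q, potWeight ω₂ lam β T N q :=
  integral_exp_pos (integrable_potWeight hω hl hβ hT)

/-- **Domination principle**: a continuous `g` with `|g| ≤ A·exp(U_N/(2T))` has `g·w_T` integrable (`|g| w_T ≤ A w_{2T}`).
[folklore] -/
theorem integrable_mul_potWeight_of_le (hω : 0 < ω₂) (hl : 0 ≤ lam) (hβ : 0 ≤ β) (hT : 0 < T)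
    {g : (Fin N → ℝ) → ℝ} (hg : Continuous g) {A : ℝ}
    (hb : ∀ q, |g q| ≤ A * Real.exp (potEnergy ω₂ lam β N q / (2 * T))) :
    Integrable fun q => g q * potWeight ω₂ lam β T N q := by
  have h2T : 0 < 2 * T := by positivity
  have hI := (integrable_potWeight (N := N) hω hl hβ h2T).const_mul A
  refine hI.mono' (hg.mul continuous_potWeight).aestronglyMeasurable (Eventually.of_forall fun q => ?_)
  rw [Real.norm_eq_abs, abs_mul, abs_of_pos (potWeight_pos _ _ _ _ _ _)]
  calc |g q| * potWeight ω₂ lam β T N q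
      ≤ A * Real.exp (potEnergy ω₂ lam β N q / (2 * T)) * potWeight ω₂ lam β T N q :=
        mul_le_mul_of_nonneg_right (hb q) (potWeight_pos _ _ _ _ _ _).le
    _ = A * potWeight ω₂ lam β (2 * T) N q := by
        simp only [potWeight, mul_assoc, ← Real.exp_add]
        congr 2
        ring

/-- **Even moments are exponentially dominated**: `(qᵢ²)ⁿ ≤ n!·(4T/ω₂)ⁿ·exp(U_N(q)/(2T))` (from `xⁿ/n! ≤ eˣ` at
`x = ω₂qᵢ²/(4T) ≤ U_N/(2T)`). [folklore] -/
theorem sq_pow_le_exp (hω : 0 < ω₂) (hl : 0 ≤ lam) (hβ : 0 ≤ β) (hT : 0 < T) (q : Fin N → ℝ) (i : Fin N)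
    (n : ℕ) :
    (q i ^ 2) ^ n ≤ (n.factorial : ℝ) * (4 * T / ω₂) ^ n * Real.exp (potEnergy ω₂ lam β N q / (2 * T)) := by
  set x : ℝ := ω₂ / (4 * T) * q i ^ 2 with hx
  have hx0 : 0 ≤ x := by positivity
  have h1 : x ^ n / (n.factorial : ℝ) ≤ Real.exp x := Real.pow_div_factorial_le_exp x hx0 n
  have h2 : Real.exp x ≤ Real.exp (potEnergy ω₂ lam β N q / (2 * T)) := by
    refine Real.exp_le_exp.mpr ?_
    have hU := sq_le_potEnergy hω.le hl hβ q i
    rw [hx, show ω₂ / (4 * T) * q i ^ 2 = (ω₂ * q i ^ 2 / 2) / (2 * T) by field_simp; ring]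
    exact div_le_div_of_nonneg_right hU (by positivity)
  have hfac : (0 : ℝ) < (n.factorial : ℝ) := by positivity
  have h3 : x ^ n ≤ (n.factorial : ℝ) * Real.exp (potEnergy ω₂ lam β N q / (2 * T)) := by
    rw [div_le_iff₀ hfac] at h1
    nlinarith [h1, h2, hfac]
  have hxn : x ^ n = (ω₂ / (4 * T)) ^ n * (q i ^ 2) ^ n := by rw [hx, mul_pow]
  rw [hxn] at h3
  have hinv : (4 * T / ω₂) ^ n * (ω₂ / (4 * T)) ^ n = 1 := by
    rw [← mul_pow, show 4 * T / ω₂ * (ω₂ / (4 * T)) = 1 by field_simp, one_pow]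
  calc (q i ^ 2) ^ n = (4 * T / ω₂) ^ n * ((ω₂ / (4 * T)) ^ n * (q i ^ 2) ^ n) := by
        rw [← mul_assoc, hinv, one_mul]
    _ ≤ (4 * T / ω₂) ^ n * ((n.factorial : ℝ) * Real.exp (potEnergy ω₂ lam β N q / (2 * T))) :=
        mul_le_mul_of_nonneg_left h3 (by positivity)
    _ = _ := by ring

/-- `|x|ᵏ ≤ 1 + x⁶` for `k ≤ 6`. [folklore] -/
theorem abs_pow_le_one_add_pow_six (x : ℝ) {k : ℕ} (hk : k ≤ 6) : |x| ^ k ≤ 1 + x ^ 6 := by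
  have h6 : (0 : ℝ) ≤ x ^ 6 := by positivity
  rcases le_or_gt |x| 1 with h | h
  · exact (pow_le_one₀ (abs_nonneg x) h).trans (by linarith)
  · calc |x| ^ k ≤ |x| ^ 6 := pow_le_pow_right₀ h.le hk
      _ = x ^ 6 := by rw [pow_abs, abs_of_nonneg h6]
      _ ≤ 1 + x ^ 6 := by linarith

/-- **Polynomial site moments are integrable**: `qᵢᵏ w ∈ L¹` for `k ≤ 6` (domination by `(1 + qᵢ⁶) w`). [folklore] -/
theorem integrable_pow_mul_potWeight (hω : 0 < ω₂) (hl : 0 ≤ lam) (hβ : 0 ≤ β) (hT : 0 < T) (i : Fin N)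
    {k : ℕ} (hk : k ≤ 6) :
    Integrable fun q => q i ^ k * potWeight ω₂ lam β T N q := by
  have hdom : Integrable fun q => (1 + q i ^ 6) * potWeight ω₂ lam β T N q := by
    refine integrable_mul_potWeight_of_le hω hl hβ hT (g := fun q : Fin N → ℝ => 1 + q i ^ 6)
      (A := 1 + ((3 : ℕ).factorial : ℝ) * (4 * T / ω₂) ^ 3) (by fun_prop) (fun q => ?_)
    have h0 : 0 ≤ potEnergy ω₂ lam β N q := potEnergy_nonneg hω.le hl hβ q
    have he : 1 ≤ Real.exp (potEnergy ω₂ lam β N q / (2 * T)) := Real.one_le_exp (by positivity)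
    have h6 := sq_pow_le_exp hω hl hβ hT q i 3
    rw [← pow_mul] at h6
    have hq6 : (0 : ℝ) ≤ q i ^ 6 := by positivity
    rw [abs_of_nonneg (by linarith)]
    have hc : (0 : ℝ) ≤ ((3 : ℕ).factorial : ℝ) * (4 * T / ω₂) ^ 3 := by positivity
    nlinarith [h6, he, hc]
  refine hdom.mono' (((continuous_apply i).pow k).mul continuous_potWeight).aestronglyMeasurable
    (Eventually.of_forall fun q => ?_)
  rw [Real.norm_eq_abs, abs_mul, abs_of_pos (potWeight_pos _ _ _ _ _ _), abs_pow]
  exact mul_le_mul_of_nonneg_right (abs_pow_le_one_add_pow_six (q i) hk) (potWeight_pos _ _ _ _ _ _).le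

/-- The coordinate derivative of a coordinate monomial: `∂ⱼ(qᵢᵏ) = [j = i]·k·qᵢᵏ⁻¹`. [folklore] -/
theorem coordDeriv_pow (i j : Fin N) (k : ℕ) (q : Fin N → ℝ) :
    coordDeriv j (fun q : Fin N → ℝ => q i ^ k) q = if j = i then (k : ℝ) * q i ^ (k - 1) else 0 := by
  unfold coordDeriv
  by_cases h : j = i
  · subst h
    simp only [Function.update_self, if_true]
    exact (hasDerivAt_pow k (q j)).deriv
  · have hne : i ≠ j := fun e => h e.symm
    simp only [Function.update_of_ne hne, if_neg h, deriv_const]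

/-- `∑ⱼ (∂ⱼ qᵢᵏ)² = (k qᵢᵏ⁻¹)²`. [folklore] -/
theorem sum_coordDeriv_pow_sq (i : Fin N) (k : ℕ) (q : Fin N → ℝ) :
    ∑ j, coordDeriv j (fun q : Fin N → ℝ => q i ^ k) q ^ 2 = ((k : ℝ) * q i ^ (k - 1)) ^ 2 := by
  simp only [coordDeriv_pow]
  rw [Finset.sum_eq_single i (fun j _ hj => by simp [hj]) (by simp)]
  simp

/-- `∫ f² w ≤ 2 ∫ (f − m)² w + 2 m² ∫ w` for any centring `m`. [folklore] -/
theorem integral_sq_mul_le_of_centred {f : (Fin N → ℝ) → ℝ} (m : ℝ)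
    (h1 : Integrable fun q => f q * potWeight ω₂ lam β T N q)
    (h2 : Integrable fun q => f q ^ 2 * potWeight ω₂ lam β T N q)
    (hw : Integrable (potWeight ω₂ lam β T N)) :
    Integrable (fun q => (f q - m) ^ 2 * potWeight ω₂ lam β T N q) ∧
    ∫ q, f q ^ 2 * potWeight ω₂ lam β T N q ≤
      2 * (∫ q, (f q - m) ^ 2 * potWeight ω₂ lam β T N q) + 2 * m ^ 2 * ∫ q, potWeight ω₂ lam β T N q := by
  have hI : Integrable (fun q => (f q - m) ^ 2 * potWeight ω₂ lam β T N q) := by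
    have := (h2.sub (h1.const_mul (2 * m))).add (hw.const_mul (m ^ 2))
    refine this.congr (Eventually.of_forall fun q => ?_)
    simp only [Pi.add_apply, Pi.sub_apply]
    ring
  refine ⟨hI, ?_⟩
  have hle : ∀ q, f q ^ 2 * potWeight ω₂ lam β T N q ≤
      2 * ((f q - m) ^ 2 * potWeight ω₂ lam β T N q) + 2 * m ^ 2 * potWeight ω₂ lam β T N q := fun q => by
    have hw0 := (potWeight_pos ω₂ lam β T N q).le
    nlinarith [mul_nonneg (sq_nonneg (f q - 2 * m)) hw0]
  calc ∫ q, f q ^ 2 * potWeight ω₂ lam β T N q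
      ≤ ∫ q, (2 * ((f q - m) ^ 2 * potWeight ω₂ lam β T N q) + 2 * m ^ 2 * potWeight ω₂ lam β T N q) :=
        integral_mono h2 ((hI.const_mul 2).add (hw.const_mul (2 * m ^ 2))) hle
    _ = 2 * (∫ q, (f q - m) ^ 2 * potWeight ω₂ lam β T N q) + 2 * m ^ 2 * ∫ q, potWeight ω₂ lam β T N q := by
        rw [integral_add (hI.const_mul 2) (hw.const_mul (2 * m ^ 2)), integral_const_mul, integral_const_mul]

end Position

end EnergyFluctuation

end Summit.AtomisticToContinuum.FouriersLaw.Theorems.BoundedResponse.ParityFloor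

end
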